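import Mathlib
import HarnessLib
import Summits.ValiantsHypothesis.ValiantsHypothesis.Theorems.MonotoneRestorationOrbitRestorationQPSmlAffinePermanentExp
import Summits.ValiantsHypothesis.ValiantsHypothesis.Theorems.MonotoneRestorationQP.Negative.LoadBearing

/-!
# The permanent lies outside the affine set-multilinear class at every QUASI-POLYNOMIAL budget
(crux `OrbitRestorationQP`, stmt-ValiantsHypothesis-18293 — lane SML of stub A_∞; calibration of the landed stratum against the
route's deciding family)

`…SmlAffinePermanentExp.lean`: every affine column- or row-set-multilinear `ΣΠΣ` expression of `per_n` has `≥ 2^{⌊n/3⌋}` product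
gates.  Since `(log₂ n + c)^c < n/3` eventually (`MonotoneRestorationQP.Negative.polylog_pow_lt_linear`), the permanent has, for
every exponent `c` and all large `n`, NO such expression with `≤ 2^((log₂ n + c)^c)` gates — in particular none with `≤ n^c + c`:

* `eight_mul_polylog_lt` — `8 (log₂ n + c)^c < n` for `n ≥ n₀(c)`;
* `perm_affineColSml_qp_lt`, `perm_affineRowSml_qp_lt` — **for `n ≥ n₀(c)`, every affine column- (row-) set-multilinear
  expression of `per_n` has MORE than `2^((log₂ n + c)^c)` product gates;**
* `perPoly_eventually_not_affineSml` — hence the family `per` is eventually outside the hypothesis class of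
  `SmlAffineRestoration.affineSml_restoration` for every exponent (the stratum is consistent with Dawar–Wilsenach Thm 7.1, which
  puts `per` outside the CONCLUSION).

Honest label: calibration of a restricted-model stratum; nothing here bears on general `ΣΠΣ` or on VP ≠ VNP. [folklore]
-/

noncomputable section

open scoped Classical

-- `Summit.ValiantsHypothesis.ValiantsHypothesis.…` is the tree's single-conjunct layout (Sub = Summit).
set_option linter.dupNamespace false

namespace Summit.ValiantsHypothesis.ValiantsHypothesis.Theorems.SmlAffinePermanent

open MvPolynomial Finset Literature.Computability.AlgebraicComplexity SmlAffineRestoration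

/-- `8 (log₂ n + c)^c < n` for all large `n`. [folklore] -/
theorem eight_mul_polylog_lt (c : ℕ) : ∃ n₀ : ℕ, ∀ n : ℕ, n₀ ≤ n → 8 * (Nat.log 2 n + c) ^ c < n := by
  obtain ⟨n₀, h⟩ := MonotoneRestorationQP.Negative.polylog_pow_lt_linear c (δ := 1 / 8) (by norm_num)
  refine ⟨n₀, fun n hn => ?_⟩
  have h1 := h n hn
  have h2 : ((8 * (Nat.log 2 n + c) ^ c : ℕ) : ℝ) < (n : ℝ) := by
    push_cast
    linarith
  exact_mod_cast h2

/-- `(log₂ n + c)^c < ⌊n/3⌋` for all large `n`. [folklore] -/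
theorem polylog_lt_div_three (c : ℕ) : ∃ n₀ : ℕ, ∀ n : ℕ, n₀ ≤ n → (Nat.log 2 n + c) ^ c < n / 3 := by
  obtain ⟨n₀, h⟩ := eight_mul_polylog_lt c
  refine ⟨n₀, fun n hn => ?_⟩
  have h1 := h n hn
  have hx : 1 ≤ (Nat.log 2 n + c) ^ c := by
    rcases Nat.eq_zero_or_pos c with rfl | hc
    · simp
    · exact Nat.one_le_pow _ _ (by omega)
  omega

/-- **For large `n`, every affine COLUMN-set-multilinear `ΣΠΣ` expression of `per_n` has more than `2^((log₂ n + c)^c)` product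
gates.** [folklore] -/
theorem perm_affineColSml_qp_lt (c : ℕ) : ∃ n₀ : ℕ, ∀ n : ℕ, n₀ ≤ n →
    ∀ (s : ℕ) (β : Fin s → Fin n → ℂ) (α : Fin s → Fin n → Fin n → ℂ),
      (∑ t : Fin s, ∏ b : Fin n, (C (β t b) + ∑ a : Fin n, C (α t b a) * X (a, b)) :
        MvPolynomial (Fin n × Fin n) ℂ) = perPoly (Fin n) ℂ →
      2 ^ ((Nat.log 2 n + c) ^ c) < s := by
  obtain ⟨n₀, h⟩ := polylog_lt_div_three c
  refine ⟨n₀, fun n hn s β α hper => ?_⟩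
  calc 2 ^ ((Nat.log 2 n + c) ^ c) < 2 ^ (n / 3) := Nat.pow_lt_pow_right (by norm_num) (h n hn)
    _ ≤ s := perm_affineColSml_two_pow_le β α hper

/-- **The same for affine ROW-set-multilinear expressions of `per_n`.** [folklore] -/
theorem perm_affineRowSml_qp_lt (c : ℕ) : ∃ n₀ : ℕ, ∀ n : ℕ, n₀ ≤ n →
    ∀ (s : ℕ) (β : Fin s → Fin n → ℂ) (α : Fin s → Fin n → Fin n → ℂ),
      (∑ t : Fin s, ∏ a : Fin n, (C (β t a) + ∑ b : Fin n, C (α t a b) * X (a, b)) :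
        MvPolynomial (Fin n × Fin n) ℂ) = perPoly (Fin n) ℂ →
      2 ^ ((Nat.log 2 n + c) ^ c) < s := by
  obtain ⟨n₀, h⟩ := polylog_lt_div_three c
  refine ⟨n₀, fun n hn s β α hper => ?_⟩
  calc 2 ^ ((Nat.log 2 n + c) ^ c) < 2 ^ (n / 3) := Nat.pow_lt_pow_right (by norm_num) (h n hn)
    _ ≤ s := perm_affineRowSml_two_pow_le β α hper

/-- **The permanent family is eventually outside the affine set-multilinear class, for every exponent** — even with the
quasi-polynomial budget `2^((log₂ n + c)^c)` in place of `n^c + c`. [folklore] -/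
theorem perPoly_eventually_not_affineSml (c : ℕ) : ∃ n₀ : ℕ, ∀ n : ℕ, n₀ ≤ n →
    ¬ ∃ (s : ℕ) (β : Fin s → Fin n → ℂ) (α : Fin s → Fin n → Fin n → ℂ), s ≤ 2 ^ ((Nat.log 2 n + c) ^ c) ∧
      (perPoly (Fin n) ℂ = ∑ t : Fin s, ∏ b : Fin n, (C (β t b) + ∑ a : Fin n, C (α t b a) * X (a, b)) ∨
       perPoly (Fin n) ℂ = ∑ t : Fin s, ∏ a : Fin n, (C (β t a) + ∑ b : Fin n, C (α t a b) * X (a, b))) := by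
  obtain ⟨n₁, h₁⟩ := perm_affineColSml_qp_lt c
  obtain ⟨n₂, h₂⟩ := perm_affineRowSml_qp_lt c
  refine ⟨max n₁ n₂, fun n hn => ?_⟩
  rintro ⟨s, β, α, hs, hper | hper⟩
  · exact absurd hs (not_le.2 (h₁ n (le_trans (le_max_left _ _) hn) s β α hper.symm))
  · exact absurd hs (not_le.2 (h₂ n (le_trans (le_max_right _ _) hn) s β α hper.symm))

end Summit.ValiantsHypothesis.ValiantsHypothesis.Theorems.SmlAffinePermanent

end
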